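import Summits.Ventures.PercRepro.RankLevelSetDeleteMono
import Summits.Ventures.PercRepro.RankLevelSetDeleteMonoUnexposed

/-!
# PercRepro — C-025 from the deletion door on ALL-EXPOSED cores only (night-1, gen 11)

`c025_of_deleteMonoExistsExposedCore`: the hypothesis (MD′∃) of `RankLevelSetDeleteMono` is needed only on the
cores in which EVERY element `e` is EXPOSED at level `q` — admits an `e`-free partition of `E ∖ e` into a
rank-`(p−1)` side and a rank-`q` side (`0 < freeCount M e (p − 1) q`, i.e. `e` is a free coloop of some
`U(p,q)`-partition).  On a core with an unexposed element `e`, `slack_delete_le_of_unexposed'` and the induction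
hypothesis on `M ／ {e}` at `(p − 1, q − 1)` give (MD′) at `e` for free.  Everything else is the wrapper of
`c025_of_contractMonoExistsCore` (gen 7), verbatim.  Axioms: standard.
-/

open scoped Matroid

namespace PercRepro

namespace ThmN

open Set

variable {α : Type}

/-- **(MD′∃) ON ALL-EXPOSED CORES**: for every simple, rank-`p`, coloop-free finite matroid in which every element
admits an `e`-free partition, every `q ≥ 1`, `q + 2 ≤ p`, `|E| > p + q`, in which moreover EVERY element is exposed
at level `q` (`0 < n⁰⁰_{p−1,q}(e)`), some element `e` has `σ_{M ＼ {e}}(p, q) ≤ σ_M(p, q)`. -/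
def DeleteMonoExistsExposedCore : Prop :=
  ∀ {α : Type} (M : Matroid α) [M.Finite] (p q : ℕ), 1 ≤ q → q + 2 ≤ p →
    (∀ e ∈ M.E, ∀ f ∈ M.E, e ≠ f → M.eRk {e, f} = 2) → M.eRank = (p : ℕ∞) →
    (∀ e, ¬ M.IsColoop e) →
    (∀ e ∈ M.E, ∃ A ⊆ M.E \ {e}, e ∉ M.closure A ∧ e ∉ M.closure ((M.E \ {e}) \ A)) →
    (∀ e ∈ M.E, 0 < Matroid.freeCount M e (p - 1) q) →
    p + q < M.E.ncard →
    ∃ e ∈ M.E, Matroid.slack (M ＼ {e}) p q ≤ Matroid.slack M p q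

/-- (MD′∃) on cores implies it on all-exposed cores. -/
theorem deleteMonoExistsExposedCore_of_deleteMonoExistsCore (h : DeleteMonoExistsCore) :
    DeleteMonoExistsExposedCore :=
  fun M _ p q hq hpq hs hR hC hU _ hbig => h M p q hq hpq hs hR hC hU hbig

/-- The core step on a rank-`p` matroid, `|E| > p + q`, from the all-exposed hypothesis and the induction
hypotheses (on `M ＼ {e}` at `(p, q)` and on `M ／ {e}` at `(p − 1, q − 1)` for every `e ∈ E`). -/
theorem RLS_of_exposed_door (hcore : DeleteMonoExistsExposedCore) (M : Matroid α) [M.Finite] {p q : ℕ}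
    (hq : 1 ≤ q) (hpq : q + 2 ≤ p) (hs : ∀ e ∈ M.E, ∀ f ∈ M.E, e ≠ f → M.eRk {e, f} = 2)
    (hR : M.eRank = (p : ℕ∞)) (hC : ∀ e, ¬ M.IsColoop e)
    (hU : ∀ e ∈ M.E, ∃ A ⊆ M.E \ {e}, e ∉ M.closure A ∧ e ∉ M.closure ((M.E \ {e}) \ A))
    (hbig : p + q < M.E.ncard) (hL : ∀ e ∈ M.E, M.IsNonloop e)
    (ihdel : ∀ e ∈ M.E, RLS (M ＼ {e}) p q) (ihcon : ∀ e ∈ M.E, RLS (M ／ {e}) (p - 1) (q - 1)) :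
    RLS M p q := by
  classical
  by_cases hexp : ∀ e ∈ M.E, 0 < Matroid.freeCount M e (p - 1) q
  · obtain ⟨e, he, hMD⟩ := hcore M p q hq hpq hs hR hC hU hexp hbig
    exact RLS_of_delete_slack M hMD (ihdel e he)
  · push Not at hexp
    obtain ⟨e, he, hfree⟩ := hexp
    have heI : M.Indep {e} := _root_.Matroid.indep_singleton.2 (hL e he)
    have hIH : 0 ≤ Matroid.slack (M ／ {e}) (p - 1) (q - 1) :=
      (RLS_iff_slack_nonneg _ _ _).1 (ihcon e he)
    exact RLS_of_delete_slack M
      (Matroid.slack_delete_le_of_unexposed' heI hq hpq hR (Nat.le_zero.1 hfree) hIH) (ihdel e he)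

/-- **C-025 FROM (MD′∃) ON ALL-EXPOSED CORES** — strong induction on `|E|` for all `(p, q)` at once, the cell's
reductions for everything that is not a core strictly above the tight layer, the unexposed-element theorem on
cores with an unexposed element, the hypothesis only on all-exposed cores. -/
theorem c025_of_deleteMonoExistsExposedCore (hcore : DeleteMonoExistsExposedCore) : C025 := by
  suffices H : ∀ n : ℕ, ∀ {α : Type} (M : Matroid α) [M.Finite], M.E.ncard = n → ∀ p q : ℕ, q + 2 ≤ p →
      RLS M p q by
    intro α M _ p q hpq
    exact H _ M rfl p q hpq
  intro n
  induction n using Nat.strong_induction_on with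
  | _ n ih =>
  intro α M _ hn p q hpq
  classical
  -- `q = 0` is Theorem A
  rcases Nat.eq_zero_or_pos q with hq0 | hq1
  · subst hq0
    exact c025_of_q_zero (M := M) p
  have hdel : ∀ e ∈ M.E, (M ＼ {e}).E.ncard < n := by
    intro e he
    rw [_root_.Matroid.delete_ground, ← hn, ← Set.ncard_sdiff_singleton_add_one he M.ground_finite]
    omega
  have hcon : ∀ e ∈ M.E, (M ／ {e}).E.ncard < n := by
    intro e he
    rw [_root_.Matroid.contract_ground, ← hn, ← Set.ncard_sdiff_singleton_add_one he M.ground_finite]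
    omega
  -- Case 1: a loop
  by_cases hL : ∃ e ∈ M.E, M.IsLoop e
  · obtain ⟨e, he, hloopE⟩ := hL
    exact RLS_of_loop_q M hloopE p q (ih _ (hdel e he) (M ＼ {e}) rfl p q hpq)
  push Not at hL
  -- Case 2: a parallel pair
  by_cases hP : ∃ e ∈ M.E, ∃ e' ∈ M.E, e' ≠ e ∧ e ∈ M.closure {e'}
  · obtain ⟨e, he, e', he', hne, hpar⟩ := hP
    have heI : M.Indep {e} := _root_.Matroid.indep_singleton.2 ((_root_.Matroid.not_isLoop_iff he).1 (hL e he))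
    obtain ⟨p', rfl⟩ : ∃ p', p = p' + 1 := ⟨p - 1, by omega⟩
    obtain ⟨q', rfl⟩ : ∃ q', q = q' + 1 := ⟨q - 1, by omega⟩
    exact RLS_of_parallel_q M heI he' hne hpar (ih _ (hdel e he) (M ＼ {e}) rfl (p' + 1) (q' + 1) hpq)
      (ih _ (hcon e he) (M ／ {e}) rfl p' q' (by omega))
  push Not at hP
  -- Case 3: simple
  have hs : ∀ e ∈ M.E, ∀ f ∈ M.E, e ≠ f → M.eRk {e, f} = 2 :=
    fun e he f hf hef => eRk_pair_eq_two_of_simple M hL (fun e he e' he' hne => hP e he e' he' hne) he hf hef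
  -- the tight layer and below: Theorem M
  rcases lt_trichotomy M.E.ncard (p + q) with hsmall | htight | hbig
  · exact RLS_of_ncard_lt M hsmall
  · exact RLS_of_ncard_eq M htight
  rcases lt_trichotomy M.eRank (p : ℕ∞) with hlt | heq | hgt
  · exact RLS_of_eRank_lt M hlt
  · -- `ρ(E) = p`
    by_cases hC : ∃ e, M.IsColoop e
    · obtain ⟨e, hcol⟩ := hC
      obtain ⟨p', rfl⟩ : ∃ p', p = p' + 1 := ⟨p - 1, by omega⟩
      obtain ⟨q', rfl⟩ : ∃ q', q = q' + 1 := ⟨q - 1, by omega⟩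
      refine RLS_of_coloop_q M (by omega) hcol heq ?_
      rcases Nat.lt_or_ge (q' + 2) p' with h | h
      · exact ih _ (hdel e hcol.mem_ground) (M ＼ {e}) rfl p' (q' + 1) (by omega)
      · exact RLS_of_le (M ＼ {e}) (by omega)
    · push Not at hC
      -- an element without an `e`-free partition closes the step
      by_cases hU : ∃ e ∈ M.E, ∀ A ⊆ M.E \ {e}, e ∈ M.closure A ∨ e ∈ M.closure ((M.E \ {e}) \ A)
      · obtain ⟨e, he, hunsp⟩ := hU
        have heI : M.Indep {e} := _root_.Matroid.indep_singleton.2 ((_root_.Matroid.not_isLoop_iff he).1 (hL e he))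
        obtain ⟨p', rfl⟩ : ∃ p', p = p' + 1 := ⟨p - 1, by omega⟩
        obtain ⟨q', rfl⟩ : ∃ q', q = q' + 1 := ⟨q - 1, by omega⟩
        exact RLS_of_unspanned_q M heI hunsp (ih _ (hdel e he) (M ＼ {e}) rfl (p' + 1) (q' + 1) hpq)
          (ih _ (hcon e he) (M ／ {e}) rfl p' q' (by omega))
      · push Not at hU
        -- the core
        exact RLS_of_exposed_door hcore M hq1 hpq hs heq hC (fun e he => by
            obtain ⟨A, hA, h⟩ := hU e he
            exact ⟨A, hA, h.1, h.2⟩) hbig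
          (fun e he => (_root_.Matroid.not_isLoop_iff he).1 (hL e he))
          (fun e he => ih _ (hdel e he) (M ＼ {e}) rfl p q hpq)
          (fun e he => ih _ (hcon e he) (M ／ {e}) rfl (p - 1) (q - 1) (by omega))
  · -- `ρ(E) > p`: truncate, then the same dichotomy on the truncation (same ground set)
    have hp2 : 2 ≤ p := by omega
    set T := Matroid.truncate M p with hTdef
    have hTs := truncate_pair_eRk M hp2 hs
    have hTR := truncate_eRank_eq M hgt
    have hTc := truncate_no_coloop M hgt
    have hTE : T.E = M.E := Matroid.truncate_ground M p
    have hTn : T.E.ncard = n := by rw [hTE, hn]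
    have hTbig : p + q < T.E.ncard := by rw [hTE]; exact hbig
    have hconT : ∀ e ∈ T.E, (T ／ {e}).E.ncard < n := by
      intro e he
      rw [_root_.Matroid.contract_ground, ← hTn, ← Set.ncard_sdiff_singleton_add_one he T.ground_finite]
      omega
    have hdelT : ∀ e ∈ T.E, (T ＼ {e}).E.ncard < n := by
      intro e he
      rw [_root_.Matroid.delete_ground, ← hTn, ← Set.ncard_sdiff_singleton_add_one he T.ground_finite]
      omega
    have hTL : ∀ e ∈ T.E, T.IsNonloop e := by
      intro e he
      have heT : T.Indep {e} := by
        rw [Matroid.truncate_indep_iff]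
        refine ⟨_root_.Matroid.indep_singleton.2 ((_root_.Matroid.not_isLoop_iff (hTE ▸ he)).1 (hL e (hTE ▸ he))), ?_⟩
        rw [Set.ncard_singleton]; omega
      exact _root_.Matroid.indep_singleton.1 heT
    have hT : RLS T p q := by
      by_cases hU : ∃ e ∈ T.E, ∀ A ⊆ T.E \ {e}, e ∈ T.closure A ∨ e ∈ T.closure ((T.E \ {e}) \ A)
      · obtain ⟨e, he, hunsp⟩ := hU
        have heT : T.Indep {e} := _root_.Matroid.indep_singleton.2 (hTL e he)
        obtain ⟨p', rfl⟩ : ∃ p', p = p' + 1 := ⟨p - 1, by omega⟩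
        obtain ⟨q', rfl⟩ : ∃ q', q = q' + 1 := ⟨q - 1, by omega⟩
        exact RLS_of_unspanned_q T heT hunsp (ih _ (hdelT e he) (T ＼ {e}) rfl (p' + 1) (q' + 1) hpq)
          (ih _ (hconT e he) (T ／ {e}) rfl p' q' (by omega))
      · push Not at hU
        exact RLS_of_exposed_door hcore T hq1 hpq hTs hTR hTc (fun e he => by
            obtain ⟨A, hA, h⟩ := hU e he
            exact ⟨A, hA, h.1, h.2⟩) hTbig hTL
          (fun e he => ih _ (hdelT e he) (T ＼ {e}) rfl p q hpq)
          (fun e he => ih _ (hconT e he) (T ／ {e}) rfl (p - 1) (q - 1) (by omega))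
    unfold RLS at hT ⊢
    exact Matroid.rls_of_truncate M p (by omega) (phiK p q) (by unfold phiK; positivity) hT

end ThmN

end PercRepro
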